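import Summits.BirchSwinnertonDyer.BirchSwinnertonDyer.Theorems.ManinLocalTwoThreeShimuraKernelAtkinLehnerSigns
import Summits.BirchSwinnertonDyer.BirchSwinnertonDyer.Theorems.ManinLocalTwoThreeShimuraQuotientFrickeParity
import Literature.NumberTheory.EllipticCurves.AtkinLehnerInvolutionsNewformProofs
import HarnessLib

/-!
# EXACTLY ONE Atkin–Lehner minus prime on E-an-221's habitat (unconditional)
(route `ManinLocalTwoThree`, crux C3 stmt-BirchSwinnertonDyer-22968; cell bsd-f2-manin, C3 LEAD p1 gen 17; `--supports stmt-BirchSwinnertonDyer-22968`; node E-an-221 — ninth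
habitat file: Fricke parity (`frickeEigenvalue f = −1`, p741278) + the product formula `ε_N = ∏_{p ∣ N} λ(Q_p)` (tree theorem
`IsNewform0.frickeEigenvalue_eq_prod_atkinLehnerEigenvalueAt_holds`, Knapp 9.27(c)) give EXISTENCE of a prime `p ∣ N` with `λ(Q_p) = −1`; the sign pattern
(p742140, no two coprime minus divisors) gives UNIQUENESS.)

HONEST FRAMING.  Unconditional; E-an-221 on its habitat, RES₃♭, C3, Manin's conjecture and BSD are NOT proved.  No definitions, no named facts, no sorry.
[cite: Knapp1993, Thm. 9.27(b)(c)] [cite: AtkinLehner1970, Thm. 3]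
-/

set_option autoImplicit false
-- lint-debt: the directory name repeats the summit name (sibling precedent `ManinLocalTwoThreeShimuraKernelAtkinLehnerSigns.lean`)
set_option linter.dupNamespace false

noncomputable section

open scoped Classical MatrixGroups ModularForm PeriodPair
open CongruenceSubgroup Complex
open WeierstrassCurve Literature.NumberTheory.EllipticCurves Literature.NumberTheory.EllipticCurves.ModularForms
open Summit.BirchSwinnertonDyer.Rank1Residual.ManinAdditive.UDCKummerLine
open Summit.BirchSwinnertonDyer.Rank1Residual.ManinAdditive.UDCKummerLineK
open Summit.BirchSwinnertonDyer.Rank1Residual.ManinAdditive.ShimuraThreeTorsion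

namespace Summit.BirchSwinnertonDyer.BirchSwinnertonDyer.Theorems.ManinLocalTwoThree.SigmaHabitat

variable {W : WeierstrassCurve ℚ} {N : ℕ} [NeZero N]

/-- **EXISTENCE: a Shimura third-period at `9 ∣ N` forces some prime `p ∣ N` with Atkin–Lehner eigenvalue `λ(Q_p) = −1`** (`ε_N = −1 = ∏ λ(Q_p)`, each `±1`).
[cite: Knapp1993, Thm. 9.27(c)] -/
theorem exists_atkinLehnerEigenvalueAt_eq_neg_one_of_kummerShimura (D : ModularParametrizationData W N)
    (hopt : ∀ z ∈ D.L.lattice, ∃ w ∈ periodLattice D.f, z = D.c * w) (h9 : 3 ^ 2 ∣ N)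
    {u : ℂ} (hu₂ : 3 * u ∈ D.L.lattice) (hS : KummerShimura D u) :
    ∃ p ∈ N.primeFactors, atkinLehnerEigenvalueAt D.f p = -1 := by
  have hF := frickeEigenvalue_eq_neg_one_of_kummerShimura D hopt h9 hu₂ hS
  rw [IsNewform0.frickeEigenvalue_eq_prod_atkinLehnerEigenvalueAt_holds D.isNewformOf.1] at hF
  by_contra hne
  push Not at hne
  have hall : ∀ p ∈ N.primeFactors, atkinLehnerEigenvalueAt D.f p = 1 := fun p hp ↦ by
    rcases D.isNewformOf.1.atkinLehnerEigenvalueAt_eq_one_or_eq_neg_one (Nat.prime_of_mem_primeFactors hp)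
      (Nat.dvd_of_mem_primeFactors hp) with h | h
    · exact h
    · exact absurd h (hne p hp)
  rw [Finset.prod_eq_one hall] at hF
  norm_num at hF

/-- From `λ(Q_p) = −1` to `w_{Q_p} f = −f` for the exact prime power `Q_p = p^{v_p(N)}`. [cite: Knapp1993, Thm. 9.27(b)] -/
theorem atkinLehnerInvolution_ordProj_eq_neg_of_eigenvalueAt (D : ModularParametrizationData W N) {p : ℕ} (hp : p ∈ N.primeFactors)
    (h : atkinLehnerEigenvalueAt D.f p = -1) :
    haveI : NeZero (p ^ N.factorization p) := ⟨(Nat.ordProj_pos N p).ne'⟩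
    atkinLehnerInvolution N 2 (p ^ N.factorization p) D.f = (-1 : ℂ) • D.f := by
  haveI : NeZero (p ^ N.factorization p) := ⟨(Nat.ordProj_pos N p).ne'⟩
  have hsm := D.isNewformOf.1.atkinLehnerInvolutionAt_eq_atkinLehnerEigenvalueAt_smul (Nat.prime_of_mem_primeFactors hp)
    (Nat.dvd_of_mem_primeFactors hp)
  rw [h, atkinLehnerInvolutionAt_eq (N := N) (k := (2 : ℤ)) (p := p) rfl] at hsm
  exact hsm

/-- **UNIQUENESS: on E-an-221's habitat at most one prime `p ∣ N` has `λ(Q_p) = −1`** (two of them are two coprime minus exact divisors, excluded by p742140).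
[cite: Knapp1993, Thm. 9.27(b)] [cite: AtkinLehner1970, Thm. 3] -/
theorem atkinLehnerEigenvalueAt_eq_neg_one_unique_of_kummerShimura (D : ModularParametrizationData W N)
    (hopt : ∀ z ∈ D.L.lattice, ∃ w ∈ periodLattice D.f, z = D.c * w) (h9 : 3 ^ 2 ∣ N)
    {u : ℂ} (hu₂ : 3 * u ∈ D.L.lattice) (hS : KummerShimura D u)
    {p₁ p₂ : ℕ} (hp₁ : p₁ ∈ N.primeFactors) (hp₂ : p₂ ∈ N.primeFactors)
    (h₁ : atkinLehnerEigenvalueAt D.f p₁ = -1) (h₂ : atkinLehnerEigenvalueAt D.f p₂ = -1) : p₁ = p₂ := by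
  by_contra hne
  have hq₁ : p₁.Prime := Nat.prime_of_mem_primeFactors hp₁
  have hq₂ : p₂.Prime := Nat.prime_of_mem_primeFactors hp₂
  haveI : NeZero (p₁ ^ N.factorization p₁) := ⟨(Nat.ordProj_pos N p₁).ne'⟩
  haveI : NeZero (p₂ ^ N.factorization p₂) := ⟨(Nat.ordProj_pos N p₂).ne'⟩
  obtain ⟨hd₁, hc₁⟩ := ordProj_dvd_and_coprime N hp₁
  obtain ⟨hd₂, hc₂⟩ := ordProj_dvd_and_coprime N hp₂
  have hv₁ : N.factorization p₁ ≠ 0 := (hq₁.factorization_pos_of_dvd (NeZero.ne N) (Nat.dvd_of_mem_primeFactors hp₁)).ne'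
  have hv₂ : N.factorization p₂ ≠ 0 := (hq₂.factorization_pos_of_dvd (NeZero.ne N) (Nat.dvd_of_mem_primeFactors hp₂)).ne'
  have hQ₁ : 1 < p₁ ^ N.factorization p₁ := Nat.one_lt_pow hv₁ hq₁.one_lt
  have hQ₂ : 1 < p₂ ^ N.factorization p₂ := Nat.one_lt_pow hv₂ hq₂.one_lt
  have hcop : Nat.Coprime (p₁ ^ N.factorization p₁) (p₂ ^ N.factorization p₂) :=
    Nat.Coprime.pow _ _ ((Nat.coprime_primes hq₁ hq₂).mpr hne)
  have hm₁ := atkinLehnerInvolution_ordProj_eq_neg_of_eigenvalueAt D hp₁ h₁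
  have hm₂ := atkinLehnerInvolution_ordProj_eq_neg_of_eigenvalueAt D hp₂ h₂
  have hplus := not_two_atkinLehner_minus_of_kummerShimura D hopt h9 hu₂ hS _ _ hd₁ hc₁ hQ₁ hd₂ hc₂ hQ₂ hcop hm₁
  rw [hplus] at hm₂
  have hf0 : D.f ≠ 0 := fun h0 ↦ D.isNewformOf.1.coe_ne_zero (by rw [h0]; rfl)
  have h2 : ((1 : ℂ) - -1) • D.f = 0 := by rw [sub_smul, hm₂, sub_self]
  have := (smul_eq_zero.mp h2).resolve_right hf0
  norm_num at this

/-- **EXACTLY ONE Atkin–Lehner minus prime** on E-an-221's habitat (`∃!`). [cite: Knapp1993, Thm. 9.27] -/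
theorem existsUnique_atkinLehner_minus_prime_of_kummerShimura (D : ModularParametrizationData W N)
    (hopt : ∀ z ∈ D.L.lattice, ∃ w ∈ periodLattice D.f, z = D.c * w) (h9 : 3 ^ 2 ∣ N)
    {u : ℂ} (hu₂ : 3 * u ∈ D.L.lattice) (hS : KummerShimura D u) :
    ∃! p : ℕ, p ∈ N.primeFactors ∧ atkinLehnerEigenvalueAt D.f p = -1 := by
  obtain ⟨p, hp, h⟩ := exists_atkinLehnerEigenvalueAt_eq_neg_one_of_kummerShimura D hopt h9 hu₂ hS
  exact ⟨p, ⟨hp, h⟩, fun q ⟨hq, hq'⟩ ↦ atkinLehnerEigenvalueAt_eq_neg_one_unique_of_kummerShimura D hopt h9 hu₂ hS hq hp hq' h⟩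

end Summit.BirchSwinnertonDyer.BirchSwinnertonDyer.Theorems.ManinLocalTwoThree.SigmaHabitat

end
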